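import Summits.RiemannHypothesis.RiemannHypothesis.Theorems.SemilocalNegCertEleven
import Summits.RiemannHypothesis.RiemannHypothesis.Theorems.SemilocalLogAtomsB
import HarnessLib

/-!
# Semi-local threshold of the `{∞,2,…,17}` form, negative side: `a*({2,…,17}) ≤ 95/64` (the wall `P = 19`)

Cell `rh-explicit` (HOME `run/shared/lean/pub/rh-explicit/`), seat cc-s2-4 gen7 (A4 SEMILOCAL-TABLE v0.6 extension, wall `P = 19`,
`S = S_19 = {2, 3, 5, 7, 11, 13, 17}`; class `2, …, 17 ∈ S ∌ 19`).  Honest framing: theorems about the tree's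
`weilSemilocalThreshold S`; nothing here bears on RH.  No data is trusted: nine kernel facts (`decide +kernel`) of the
PIECEWISE certificate `certSeventeen` (`WeilNegCertP`, `SemilocalNegCertPieces.lean`; window `2b = 95/32 = 2.96875`,
`log 20 − 2b = 0.027`).

Instance data: window `N = 19` (`b < (log 20)/2`), atoms = the `S`-smooth prime powers `≤ 19`: `2, 3, 4, 5, 7, 8, 9, 11, 13, 16, 17`
(`atomsSeventeen`; enclosures in `SemilocalLogAtoms.lean` (`2 … 16`) and `SemilocalLogAtomsB.lean` (`17`, `log 17` to 11 decimals
from `17 = 16(1 + 1/16)`)).  Witness (lineage B of the A4 table = cc-s2-5's Legendre/exact-moment engine with deeper tables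
`D = 24, M = 900` since `2b/π = 0.945`; bottom vector of the odd Legendre section `d = 17` at `b = 95/64`, rounded):
`Re Q_S(G)/‖G‖² = −3.7949·10⁻⁵` ⇒ **`weilSemilocalThreshold {2,…,17} ≤ 95/64 = 1.484375`** (kernel margin of the same size; bulk
`(0, 95/32]` in seven pieces, majorant `archMajorCL 10 4 5 u₀`).  Locality (`N = 19`): **`a*(S) = a*({2,…,17}) ∈ [0.8046, 95/64]`
for every finite `S` with `2, …, 17 ∈ S`, `19 ∉ S`** (DATA, cc-s2-6 blind cycle #5, two engines: `a*({2,…,17}) ∈ (1.47245, 1.472475]`).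
Folklore throughout.
-/

set_option autoImplicit false
set_option linter.dupNamespace false  -- the mandated namespace repeats `RiemannHypothesis`

noncomputable section

open Complex Filter Set MeasureTheory Topology
open scoped Real

namespace Summit.RiemannHypothesis.RiemannHypothesis.Theorems.SemilocalPolyWitness

open MeasureTheory Set Finset Real
open Literature.NumberTheory.LFunctions
open Summit.RiemannHypothesis.RiemannHypothesis.Theorems.MotivicDoor
open Summit.RiemannHypothesis.RiemannHypothesis.Theorems.MotivicDoor.SemilocalThreshold
open Summit.RiemannHypothesis.RiemannHypothesis.Theorems.MotivicDoor.SemilocalMarkov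
open LQ


/-! ### The atom table of the `{2, 3, 5, 7, 11, 13, 17}`-form on windows `b < (log 20)/2` (`N = 19`) -/

/-- The atoms of the `{2, 3, 5, 7, 11, 13, 17}`-form below `(log 20)/2`: `2, 3, 4, 5, 7, 8, 9, 11, 13, 16, 17`. -/
def atomsSeventeen : List (ℕ × AtomQ) := [atomTwo, atomThree, atomFour, atomFive, atomSeven, atomEight, atomNine, atomEleven, atomThirteen, atomSixteen, atomSeventeen]

/-- A rational lower bound of `log 20`. -/
def logSuccLoSeventeen : ℚ := 2 * logTwoLo20 + logFiveLo

/-- **The atom table encloses `({2, 3, 5, 7, 11, 13, 17}, 19)`.** -/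
theorem atomsEnclose_Seventeen : AtomsEnclose {2, 3, 5, 7, 11, 13, 17} 19 atomsSeventeen logSuccLoSeventeen where
  nodup := by decide
  lt_succ := by decide
  cover := by
    intro n hn hnot
    simp only [atomsSeventeen, atomTwo, atomThree, atomFour, atomFive, atomSeven, atomEight, atomNine, atomEleven, atomThirteen, atomSixteen, atomSeventeen, List.map_cons, List.map_nil, List.mem_cons,
      List.not_mem_nil, or_false, not_or] at hnot
    have hn' : n < 20 := Finset.mem_range.1 hn
    interval_cases n
    · exact weilSemilocalCoeff_of_not_isPrimePow _ (by decide)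
    · exact weilSemilocalCoeff_of_not_isPrimePow _ (by decide)
    · simp at hnot
    · simp at hnot
    · simp at hnot
    · simp at hnot
    · exact weilSemilocalCoeff_of_not_isPrimePow _ (by decide)
    · simp at hnot
    · simp at hnot
    · simp at hnot
    · exact weilSemilocalCoeff_of_not_isPrimePow _ (by decide)
    · simp at hnot
    · exact weilSemilocalCoeff_of_not_isPrimePow _ (by decide)
    · simp at hnot
    · exact weilSemilocalCoeff_of_not_isPrimePow _ (by decide)
    · exact weilSemilocalCoeff_of_not_isPrimePow _ (not_isPrimePow_of_two_primes_dvd Nat.prime_three (by norm_num : Nat.Prime 5) (by norm_num) (by norm_num) (by norm_num))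
    · simp at hnot
    · simp at hnot
    · exact weilSemilocalCoeff_of_not_isPrimePow _ (by decide)
    · exact weilSemilocalCoeff_prime_of_not_mem (by norm_num) (by decide)
  encl := by
    intro na hna
    simp only [atomsSeventeen, List.mem_cons, List.not_mem_nil, or_false] at hna
    rcases hna with rfl | rfl | rfl | rfl | rfl | rfl | rfl | rfl | rfl | rfl | rfl
    · exact atomTwo_encl (by decide)
    · exact atomThree_encl (by decide)
    · exact atomFour_encl (by decide)
    · exact atomFive_encl (by decide)
    · exact atomSeven_encl (by decide)
    · exact atomEight_encl (by decide)
    · exact atomNine_encl (by decide)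
    · exact atomEleven_encl (by decide)
    · exact atomThirteen_encl (by decide)
    · exact atomSixteen_encl (by decide)
    · exact atomSeventeen_encl (by decide)
  logSucc := by
    have h2 := logTwoLo20_le
    have h5 := logFiveLo_le
    have h20 : Real.log (((19 : ℕ) : ℝ) + 1) = 2 * Real.log 2 + Real.log 5 := by
      rw [show ((19 : ℕ) : ℝ) + 1 = 2 ^ 2 * 5 by norm_num, Real.log_mul (by norm_num) (by norm_num), Real.log_pow]; push_cast; ring
    rw [h20, logSuccLoSeventeen]; push_cast; linarith

/-! ### The certificates -/

/-- The degree-17 witness at `b = 95 / 64` (bottom vector of the odd Legendre section d = 17 at b = 95/64, rounded to 8 digits; lineage-B exact-engine margin Re Q_S/‖G‖² = −3.7949·10⁻⁵), in powers of `x`. -/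
def pSeventeen : List ℚ :=
  [0, -18054169300337 / 48640, 0, 1043769275504448 / 171475, 0, -220520513956704288768 / 7737809375, 0, 4171159012242506045718528 / 69833729609375, 0, -1697847725705335966682578944 / 25209976388984375, 0, 13238461757214061386038689923072 / 299368469619189453125, 0, -1842636261923437582426511578759168 / 108072017532527392578125, 0, 17537538001010359919234020867471048704 / 4876749791155298590087890625, 0, -14138813095743434891120954215751718273024 / 44012666865176569775543212890625]

/-- The piecewise certificate at `b = 95 / 64`: orders `(nA, mA, KA, Kt, nt, ne) = (10, 4, 5, 10, 40, 16)`, cuts `[1, 3 / 2, 19 / 10, 11 / 5, 5 / 2, 11 / 4, 95 / 32]`,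
claimed piece bounds and atom bound (exact rational values rounded up to integers). -/
def certSeventeen : WeilNegCertP :=
  ⟨pSeventeen, 95 / 64, 10, 4, 5, 10, 40, 16, atomsSeventeen, logSuccLoSeventeen,
   [1, 3 / 2, 19 / 10, 11 / 5, 5 / 2, 11 / 4, 95 / 32],
   [18556527109661789, 4130249409097726, 2807257958552340, 1403349972392180, 1787282606041502, 1134219109001383, 772662090958071], 89475392092819060⟩

set_option maxHeartbeats 0 in
/-- kernel fact: side conditions and the final inequality of `certSeventeen`. -/
theorem check_Seventeen_main : certSeventeen.checkMain c0SharpQ = true := by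
  decide +kernel

set_option maxHeartbeats 0 in
/-- kernel fact: the atom side of `certSeventeen`. -/
theorem check_Seventeen_atoms : certSeventeen.checkAtoms = true := by
  decide +kernel

set_option maxHeartbeats 0 in
/-- kernel fact: piece `0` of `certSeventeen`. -/
theorem check_Seventeen_piece0 : certSeventeen.checkPiece 0 = true := by
  decide +kernel

set_option maxHeartbeats 0 in
/-- kernel fact: piece `1` of `certSeventeen`. -/
theorem check_Seventeen_piece1 : certSeventeen.checkPiece 1 = true := by
  decide +kernel

set_option maxHeartbeats 0 in
/-- kernel fact: piece `2` of `certSeventeen`. -/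
theorem check_Seventeen_piece2 : certSeventeen.checkPiece 2 = true := by
  decide +kernel

set_option maxHeartbeats 0 in
/-- kernel fact: piece `3` of `certSeventeen`. -/
theorem check_Seventeen_piece3 : certSeventeen.checkPiece 3 = true := by
  decide +kernel

set_option maxHeartbeats 0 in
/-- kernel fact: piece `4` of `certSeventeen`. -/
theorem check_Seventeen_piece4 : certSeventeen.checkPiece 4 = true := by
  decide +kernel

set_option maxHeartbeats 0 in
/-- kernel fact: piece `5` of `certSeventeen`. -/
theorem check_Seventeen_piece5 : certSeventeen.checkPiece 5 = true := by
  decide +kernel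

set_option maxHeartbeats 0 in
/-- kernel fact: piece `6` of `certSeventeen`. -/
theorem check_Seventeen_piece6 : certSeventeen.checkPiece 6 = true := by
  decide +kernel

/-- all pieces of `certSeventeen` check. -/
theorem check_Seventeen_pieces : ∀ i, i < certSeventeen.cuts.length → certSeventeen.checkPiece i = true := by
  intro i hi
  have hi' : i < 7 := hi
  interval_cases i
  · exact check_Seventeen_piece0
  · exact check_Seventeen_piece1
  · exact check_Seventeen_piece2
  · exact check_Seventeen_piece3
  · exact check_Seventeen_piece4
  · exact check_Seventeen_piece5
  · exact check_Seventeen_piece6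

/-! ### The theorems -/

/-- **`a*({2,…,17}) ≤ 95/64 = 1.484375`.** -/
theorem weilSemilocalThreshold_uptoSeventeen_le :
    weilSemilocalThreshold {2, 3, 5, 7, 11, 13, 17} ≤ ((95 / 64 : ℚ) : ℝ) :=
  weilSemilocalThreshold_le_of_checkP_sharp certSeventeen atomsEnclose_Seventeen
    check_Seventeen_main check_Seventeen_atoms check_Seventeen_pieces

/-- Failure form: `{∞,2,…,17}`-positivity fails on every cone `C(B)`, `B > 95/64`. -/
theorem not_weilSemilocalPositivityOn_uptoSeventeen_of_gt {B : ℝ} (hB : (95 / 64 : ℝ) < B) :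
    ¬ WeilSemilocalPositivityOn {2, 3, 5, 7, 11, 13, 17} B := by
  rw [not_weilSemilocalPositivityOn_iff_weilSemilocalThreshold_lt]
  have h := weilSemilocalThreshold_uptoSeventeen_le
  push_cast at h
  linarith

/-- `a*({2,…,17}) < (log 20)/2`: below the window of the next index. -/
theorem weilSemilocalThreshold_uptoSeventeen_lt_log_twenty_half :
    weilSemilocalThreshold {2, 3, 5, 7, 11, 13, 17} < Real.log 20 / 2 := by
  have h := weilSemilocalThreshold_uptoSeventeen_le
  have h2 := Real.log_two_gt_d9
  have h5 := Real.log_five_gt_d9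
  have h20 : Real.log 20 = 2 * Real.log 2 + Real.log 5 := by
    rw [show (20 : ℝ) = 2 ^ 2 * 5 by norm_num, Real.log_mul (by norm_num) (by norm_num), Real.log_pow]; push_cast; ring
  push_cast at h
  rw [h20]
  linarith

/-- **The class `2, …, 17 ∈ S ∌ 19`**: `a*(S) = a*({2,…,17})` (locality at `N = 19`). -/
theorem weilSemilocalThreshold_eq_uptoSeventeen {S : Finset ℕ} (h2 : 2 ∈ S) (h3 : 3 ∈ S) (h5 : 5 ∈ S) (h7 : 7 ∈ S)
    (h11 : 11 ∈ S) (h13 : 13 ∈ S) (h17 : 17 ∈ S) (h19 : 19 ∉ S) :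
    weilSemilocalThreshold S = weilSemilocalThreshold {2, 3, 5, 7, 11, 13, 17} := by
  refine weilSemilocalThreshold_congr (S := {2, 3, 5, 7, 11, 13, 17}) (S' := S) (N := 19) ?_ ?_
  · intro n hn hpp
    interval_cases n
    · exact absurd hpp (by decide)
    · exact absurd hpp (by decide)
    · rw [Nat.prime_two.primeFactors]; simp [h2]
    · rw [Nat.prime_three.primeFactors]; simp [h3]
    · rw [show (4 : ℕ) = 2 ^ 2 by norm_num, Nat.primeFactors_prime_pow two_ne_zero Nat.prime_two]; simp [h2]
    · rw [(by norm_num : Nat.Prime 5).primeFactors]; simp [h5]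
    · exact absurd hpp (by decide)
    · rw [(by norm_num : Nat.Prime 7).primeFactors]; simp [h7]
    · rw [show (8 : ℕ) = 2 ^ 3 by norm_num, Nat.primeFactors_prime_pow (by norm_num) Nat.prime_two]; simp [h2]
    · rw [show (9 : ℕ) = 3 ^ 2 by norm_num, Nat.primeFactors_prime_pow two_ne_zero Nat.prime_three]; simp [h3]
    · exact absurd hpp (by decide)
    · rw [(by norm_num : Nat.Prime 11).primeFactors]; simp [h11]
    · exact absurd hpp (by decide)
    · rw [(by norm_num : Nat.Prime 13).primeFactors]; simp [h13]
    · exact absurd hpp (by decide)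
    · exact absurd hpp (not_isPrimePow_of_two_primes_dvd Nat.prime_three (by norm_num : Nat.Prime 5) (by norm_num)
        (by norm_num) (by norm_num))
    · rw [show (16 : ℕ) = 2 ^ 4 by norm_num, Nat.primeFactors_prime_pow (by norm_num) Nat.prime_two]; simp [h2]
    · rw [(by norm_num : Nat.Prime 17).primeFactors]; simp [h17]
    · exact absurd hpp (by decide)
    · rw [(by norm_num : Nat.Prime 19).primeFactors]; simp [h19]
  · have h := weilSemilocalThreshold_uptoSeventeen_lt_log_twenty_half
    norm_num
    exact h

/-- **`a*(S) ≤ 95/64` for every finite set of primes `S` with `2, …, 17 ∈ S`, `19 ∉ S`.** -/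
theorem weilSemilocalThreshold_le_of_mem_seventeen {S : Finset ℕ} (h2 : 2 ∈ S) (h3 : 3 ∈ S) (h5 : 5 ∈ S) (h7 : 7 ∈ S)
    (h11 : 11 ∈ S) (h13 : 13 ∈ S) (h17 : 17 ∈ S) (h19 : 19 ∉ S) :
    weilSemilocalThreshold S ≤ ((95 / 64 : ℚ) : ℝ) := by
  rw [weilSemilocalThreshold_eq_uptoSeventeen h2 h3 h5 h7 h11 h13 h17 h19]
  exact weilSemilocalThreshold_uptoSeventeen_le

/-- **The bracket of the class `2, …, 17 ∈ S ∌ 19`**: `4023/5000 ≤ a*(S) ≤ 95/64` (DATA `≈ 1.4725`). -/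
theorem weilSemilocalThreshold_mem_Icc_of_mem_seventeen {S : Finset ℕ} (h2 : 2 ∈ S) (h3 : 3 ∈ S) (h5 : 5 ∈ S)
    (h7 : 7 ∈ S) (h11 : 11 ∈ S) (h13 : 13 ∈ S) (h17 : 17 ∈ S) (h19 : 19 ∉ S) :
    weilSemilocalThreshold S ∈ Set.Icc (4023 / 5000 : ℝ) ((95 / 64 : ℚ) : ℝ) :=
  ⟨SemilocalTwoThree.le_weilSemilocalThreshold_of_two_three_8046 h2 h3,
    weilSemilocalThreshold_le_of_mem_seventeen h2 h3 h5 h7 h11 h13 h17 h19⟩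

end Summit.RiemannHypothesis.RiemannHypothesis.Theorems.SemilocalPolyWitness

end

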